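import Mathlib
import HarnessLib

/-!
# Route `UnitScaleTilt`, crux K1 «MinimiserStabilityRegPr» (stmt-QuantumFields-19200) — route-R E′ (A′)-comb, ★★OWNER g29 RULING №17 (2)∕№18 (2) open lemma COMB-FLAT-COERCIVITY,
# sub-lemma (I3′) «δQ-SLICE», FILE F-a: **AVERAGED FILLINGS — the abstract `ℓ²` bookkeeping behind «a gradient-blind multiscale functional is bounded by the curl energy»**
# (this seat's LOCATE `LOCATE-I3-COULOMB-w4g8.md` sha16 720a4c12, (L1′) + the filling pairing): Cauchy–Schwarz on the SUPPORT, the maximal-overlap bound, and the averaged-filling bound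

Cell `ym3-torus`, width seat `ym-ust-19200-w4` (gen 8; (I3′) taker per px6 g5 04:36Z «OPEN to a LOCATE-first taker», RULING №18 (2)).  THEOREMS ONLY (0 `def`, 0 `sorry`), Mathlib-only;
`--supports stmt-QuantumFields-19200`, count-neutral.  YM₃ on T³ is a ladder rung (R3), not the Clay problem; nothing here claims (I3′), COMB-FLAT-COERCIVITY, `norm_G₀ᶜ`, hcoS, E′, EX, the crux,
d = 4 or the mass gap.

WHY.  For the comb-flat coercivity row the only non-bookkeeping input is «`Σ_c‖δQ X(c)‖² ≤ C·ℓ·Σ_p‖curl X(p)‖²` with `C` L-only» ((I3′)).  `δQ` is gradient-blind, so each weight 1-chain `ω`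
of `X ↦ δQ X(c)` is CLOSED and — on a box — a BOUNDARY: `⟨ω, X⟩ = ⟨S, dX⟩` for a filling 2-chain `S` (lattice Stokes, FILE F-b).  The size of `S` is what decides K-uniformity, and the multiscale
SMEARING of `δQ` (every level built from tube means, ✓`B7Eq99Concrete.wrec_succ` ∕ ✓p695582 `Fhat L (linQIter L X j)`) makes `S` an AVERAGE of many thin fillings with small mutual overlap.
This file is the three elementary inequalities that turn that picture into numbers, over abstract finite index types (no lattice):
(1) Cauchy–Schwarz on the support: `(Σ_i a i)² ≤ #{i : a i ≠ 0}·Σ_i (a i)²`; (2) the MAXIMAL-OVERLAP bound `Σ_p (Σ_i a i p)² ≤ n_max·Σ_i Σ_p (a i p)²` when at most `n_max` of the `a · p`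
are non-zero at each `p`; (3) the FILLING PAIRING `‖Σ_p S p • Y p‖² ≤ (Σ_p (S p)²)·Σ_{p : S p ≠ 0} ‖Y p‖²` (so `‖⟨ω,X⟩‖² ≤ ‖S‖²·Σ_{supp S}‖dX‖²`); (4) the AVERAGED FILLING
`Σ_p (N⁻¹·Σ_{i} S_i p)² ≤ n_max·A∕N` when each thin filling has `Σ_p (S_i p)² ≤ A` — LOCATE (L1′): with `A ~ L^{2j+2}`, `N ~ L^{j(d−1)}` cross-section translates, `n_max ~ L^j`, this is
the per-level `‖S_j‖² ≲ L^{j+2}` in `d = 3`.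

WHAT IS PROVED (ns `…Theorems.Prop7AveragedFillings`): `sq_sum_le_card_support_mul_sum_sq`, ★`sum_sq_sum_le_maxOverlap_mul`, ★`norm_sq_sum_smul_le_of_support` (the filling pairing),
★★`sum_sq_avg_le_maxOverlap_div` (the averaged filling), `sum_sq_avg_le_of_each` (its corollary with a uniform per-filling bound `A`).
HONEST SCOPE: finite-sum inequalities; no lattice object; nothing of (I3′) is concluded here (F-b: thin Stokes on `torusT`; F-c: `δQ`'s chains explicit + the level sum).
Rung R3, not Clay; YM gap NOT proved.

References: T. Bałaban, CMP 99 (1985) 389–434 [Balaban1985BackgroundPropagators] (Thm 3.11 p.416: the coercivity whose flat comb instance this serves); CMP 98 (1985) 17–51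
[Balaban1985Averaging] ((160)–(164) p.42: the multiscale frames whose smearing the averaged-filling bound quantifies).
-/

set_option autoImplicit false

open scoped BigOperators
open Finset

namespace Summit.QuantumFields.YangMills.Theorems.Prop7AveragedFillings

/-! ## §1 Cauchy–Schwarz on the support and the maximal-overlap bound -/

/-- **CAUCHY–SCHWARZ ON THE SUPPORT**: `(Σ_{i∈s} a i)² ≤ #{i ∈ s : a i ≠ 0} · Σ_{i∈s} (a i)²`. [folklore] -/
theorem sq_sum_le_card_support_mul_sum_sq {ι : Type*} [DecidableEq ι] (s : Finset ι) (a : ι → ℝ) :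
    (∑ i ∈ s, a i) ^ 2 ≤ ((s.filter (fun i => a i ≠ 0)).card : ℝ) * ∑ i ∈ s, a i ^ 2 := by
  classical
  have h1 : ∑ i ∈ s, a i = ∑ i ∈ s.filter (fun i => a i ≠ 0), a i := by
    rw [Finset.sum_filter]
    refine Finset.sum_congr rfl fun i _ => ?_
    by_cases h : a i ≠ 0
    · rw [if_pos h]
    · rw [not_not] at h; rw [h]; simp
  have h2 : ∑ i ∈ s.filter (fun i => a i ≠ 0), a i ^ 2 ≤ ∑ i ∈ s, a i ^ 2 :=
    Finset.sum_le_sum_of_subset_of_nonneg (Finset.filter_subset _ _) (fun i _ _ => sq_nonneg _)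
  rw [h1]
  calc (∑ i ∈ s.filter (fun i => a i ≠ 0), a i) ^ 2 ≤ ((s.filter (fun i => a i ≠ 0)).card : ℝ) * ∑ i ∈ s.filter (fun i => a i ≠ 0), a i ^ 2 :=
        sq_sum_le_card_mul_sum_sq
    _ ≤ ((s.filter (fun i => a i ≠ 0)).card : ℝ) * ∑ i ∈ s, a i ^ 2 := mul_le_mul_of_nonneg_left h2 (by positivity)

/-- ★ **THE MAXIMAL-OVERLAP BOUND**: if at every `p` at most `n_max` of the numbers `a i p` (`i ∈ I`) are non-zero, then `Σ_{p∈P} (Σ_{i∈I} a i p)² ≤ n_max · Σ_{i∈I} Σ_{p∈P} (a i p)²`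
— the `ℓ²`-norm of a sum of sparsely overlapping vectors (LOCATE (L1′): fillings of translated thin loops overlap at most `n_max ~ L^j` times at a plaquette). [folklore] -/
theorem sum_sq_sum_le_maxOverlap_mul {ι π : Type*} [DecidableEq ι] (I : Finset ι) (P : Finset π) (a : ι → π → ℝ) {nmax : ℝ}
    (hover : ∀ p ∈ P, ((I.filter (fun i => a i p ≠ 0)).card : ℝ) ≤ nmax) :
    ∑ p ∈ P, (∑ i ∈ I, a i p) ^ 2 ≤ nmax * ∑ i ∈ I, ∑ p ∈ P, a i p ^ 2 := by
  calc ∑ p ∈ P, (∑ i ∈ I, a i p) ^ 2 ≤ ∑ p ∈ P, nmax * ∑ i ∈ I, a i p ^ 2 := by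
        refine Finset.sum_le_sum fun p hp => ?_
        exact (sq_sum_le_card_support_mul_sum_sq I (fun i => a i p)).trans
          (mul_le_mul_of_nonneg_right (hover p hp) (Finset.sum_nonneg fun i _ => sq_nonneg _))
    _ = nmax * ∑ i ∈ I, ∑ p ∈ P, a i p ^ 2 := by rw [← Finset.mul_sum, Finset.sum_comm]

/-! ## §2 The filling pairing: `‖Σ_p S p • Y p‖² ≤ ‖S‖² · Σ_{supp S} ‖Y p‖²` -/

/-- ★ **THE FILLING PAIRING** (vector-valued field, real 2-chain): `‖Σ_{p∈P} S p • Y p‖² ≤ (Σ_{p∈P} (S p)²) · Σ_{p ∈ P, S p ≠ 0} ‖Y p‖²` — so once lattice Stokes gives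
`⟨ω, X⟩ = Σ_p S p • (dX) p` for a filling `S` of the closed chain `ω`, the functional is bounded by `‖S‖_{ℓ²}` times the curl energy ON THE SUPPORT OF THE FILLING. [folklore] -/
theorem norm_sq_sum_smul_le_of_support {π : Type*} {W : Type*} [SeminormedAddCommGroup W] [NormedSpace ℝ W] (P : Finset π) (S : π → ℝ) (Y : π → W) :
    ‖∑ p ∈ P, S p • Y p‖ ^ 2 ≤ (∑ p ∈ P, S p ^ 2) * ∑ p ∈ P.filter (fun p => S p ≠ 0), ‖Y p‖ ^ 2 := by
  classical
  -- restrict the sum to the support of `S`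
  have h1 : ∑ p ∈ P, S p • Y p = ∑ p ∈ P.filter (fun p => S p ≠ 0), S p • Y p := by
    rw [Finset.sum_filter]
    refine Finset.sum_congr rfl fun p _ => ?_
    by_cases h : S p ≠ 0
    · rw [if_pos h]
    · rw [not_not] at h; rw [h, zero_smul]; simp
  have h2 : ∑ p ∈ P.filter (fun p => S p ≠ 0), S p ^ 2 ≤ ∑ p ∈ P, S p ^ 2 :=
    Finset.sum_le_sum_of_subset_of_nonneg (Finset.filter_subset _ _) (fun p _ _ => sq_nonneg _)
  rw [h1]
  set P' := P.filter (fun p => S p ≠ 0) with hP'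
  -- `‖Σ S•Y‖ ≤ Σ |S|‖Y‖ ≤ (Σ S²)^{1/2} (Σ ‖Y‖²)^{1/2}`
  have h3 : ‖∑ p ∈ P', S p • Y p‖ ≤ ∑ p ∈ P', |S p| * ‖Y p‖ :=
    (norm_sum_le _ _).trans (Finset.sum_le_sum fun p _ => by rw [norm_smul, Real.norm_eq_abs])
  have h4 : (∑ p ∈ P', |S p| * ‖Y p‖) ^ 2 ≤ (∑ p ∈ P', |S p| ^ 2) * ∑ p ∈ P', ‖Y p‖ ^ 2 :=
    Finset.sum_mul_sq_le_sq_mul_sq P' (fun p => |S p|) (fun p => ‖Y p‖)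
  have h5 : ∑ p ∈ P', |S p| ^ 2 = ∑ p ∈ P', S p ^ 2 := Finset.sum_congr rfl fun p _ => sq_abs _
  have h0 : 0 ≤ ∑ p ∈ P', |S p| * ‖Y p‖ := Finset.sum_nonneg fun p _ => by positivity
  calc ‖∑ p ∈ P', S p • Y p‖ ^ 2 ≤ (∑ p ∈ P', |S p| * ‖Y p‖) ^ 2 := pow_le_pow_left₀ (norm_nonneg _) h3 2
    _ ≤ (∑ p ∈ P', S p ^ 2) * ∑ p ∈ P', ‖Y p‖ ^ 2 := by rw [← h5]; exact h4
    _ ≤ (∑ p ∈ P, S p ^ 2) * ∑ p ∈ P', ‖Y p‖ ^ 2 := mul_le_mul_of_nonneg_right h2 (Finset.sum_nonneg fun p _ => sq_nonneg _)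

/-! ## §3 The averaged filling -/

/-- ★★ **THE AVERAGED-FILLING BOUND** (LOCATE (L1′)): for a finite family of fillings `S_i` (`i ∈ I`, `#I = N > 0`) overlapping at most `n_max` times at each `p`,
`Σ_{p∈P} (N⁻¹·Σ_{i∈I} S_i p)² ≤ (n_max ∕ N) · N⁻¹·Σ_{i∈I} Σ_{p∈P} (S_i p)²` — the smeared filling's `ℓ²`-norm² is the MEAN thin `ℓ²`-norm² times the overlap ratio `n_max∕N`. [folklore] -/
theorem sum_sq_avg_le_maxOverlap_div {ι π : Type*} [DecidableEq ι] (I : Finset ι) (hI : 0 < I.card) (P : Finset π) (S : ι → π → ℝ) {nmax : ℝ}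
    (hover : ∀ p ∈ P, ((I.filter (fun i => S i p ≠ 0)).card : ℝ) ≤ nmax) :
    ∑ p ∈ P, ((I.card : ℝ)⁻¹ * ∑ i ∈ I, S i p) ^ 2 ≤ (nmax / I.card) * ((I.card : ℝ)⁻¹ * ∑ i ∈ I, ∑ p ∈ P, S i p ^ 2) := by
  have hN : (0 : ℝ) < I.card := by exact_mod_cast hI
  have h1 := sum_sq_sum_le_maxOverlap_mul I P S hover
  have h2 : ∑ p ∈ P, ((I.card : ℝ)⁻¹ * ∑ i ∈ I, S i p) ^ 2 = (I.card : ℝ)⁻¹ ^ 2 * ∑ p ∈ P, (∑ i ∈ I, S i p) ^ 2 := by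
    rw [Finset.mul_sum]
    exact Finset.sum_congr rfl fun p _ => by ring
  rw [h2]
  calc (I.card : ℝ)⁻¹ ^ 2 * ∑ p ∈ P, (∑ i ∈ I, S i p) ^ 2 ≤ (I.card : ℝ)⁻¹ ^ 2 * (nmax * ∑ i ∈ I, ∑ p ∈ P, S i p ^ 2) :=
        mul_le_mul_of_nonneg_left h1 (by positivity)
    _ = (nmax / I.card) * ((I.card : ℝ)⁻¹ * ∑ i ∈ I, ∑ p ∈ P, S i p ^ 2) := by field_simp

/-- **… with a uniform per-filling bound**: if moreover `Σ_p (S_i p)² ≤ A` for every `i ∈ I`, then `Σ_p (N⁻¹Σ_i S_i p)² ≤ n_max·A∕N` — LOCATE (L1′) VERBATIM (per level `j` in `d = 3`: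
`A ≤ c·L^{2j+2}`, `N = L^{2j}`, `n_max ≤ 2L^j` ⇒ `‖S_j‖² ≤ 2c·L^{j+2}`). [folklore] -/
theorem sum_sq_avg_le_of_each {ι π : Type*} [DecidableEq ι] (I : Finset ι) (hI : 0 < I.card) (P : Finset π) (S : ι → π → ℝ) {nmax A : ℝ}
    (hover : ∀ p ∈ P, ((I.filter (fun i => S i p ≠ 0)).card : ℝ) ≤ nmax) (hnmax : 0 ≤ nmax) (hA : ∀ i ∈ I, ∑ p ∈ P, S i p ^ 2 ≤ A) :
    ∑ p ∈ P, ((I.card : ℝ)⁻¹ * ∑ i ∈ I, S i p) ^ 2 ≤ nmax * A / I.card := by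
  have hN : (0 : ℝ) < I.card := by exact_mod_cast hI
  have h1 := sum_sq_avg_le_maxOverlap_div I hI P S hover
  have h2 : (I.card : ℝ)⁻¹ * ∑ i ∈ I, ∑ p ∈ P, S i p ^ 2 ≤ A := by
    rw [inv_mul_le_iff₀ hN]
    calc ∑ i ∈ I, ∑ p ∈ P, S i p ^ 2 ≤ ∑ _i ∈ I, A := Finset.sum_le_sum hA
      _ = (I.card : ℝ) * A := by rw [Finset.sum_const, nsmul_eq_mul]
  calc ∑ p ∈ P, ((I.card : ℝ)⁻¹ * ∑ i ∈ I, S i p) ^ 2 ≤ (nmax / I.card) * ((I.card : ℝ)⁻¹ * ∑ i ∈ I, ∑ p ∈ P, S i p ^ 2) := h1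
    _ ≤ (nmax / I.card) * A := mul_le_mul_of_nonneg_left h2 (by positivity)
    _ = nmax * A / I.card := by ring

end Summit.QuantumFields.YangMills.Theorems.Prop7AveragedFillings
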